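import Literature.MathematicalPhysics.QuantumFieldTheory.Balaban1983to89.Node00.RepTowerOfRecord
import Literature.MathematicalPhysics.QuantumFieldTheory.Balaban1983to89.B15LeafKnitMass

/-!
# `Balaban1983to89.B15LeafKnitTower9` — YM-DAG node N12 · [Balaban1989LargeFieldI] CMP **122** (1989) 175–202: the N12 W-pin AT THE REPRESENTED TOWER OF
# RECORD (NODE 00 Stage ₉: definer ₇b∕₉'s `Node00.RepTowerOfRecord`, p417991) — per run `p`, couplings `g`, step `k` the [IV] bundle
# `WOfRepr (repTOfRecord9 … p g k) (ppSel p g (k+1)) (fibOfSeq … (k+1)) LF D189 D1100` read at the PRE-𝐑 representation `Tstep rep_k` of the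
# tower; its 𝐑-step IS `rep_{k+1}` of the tower, its `ρ_k` IS `𝐓ρ_k` of record, its (0.4) number is `∫dV 𝐓ρ_k`; the B15 leaf there from the
# positive-mass provisos on the tower's terms modulo EXACTLY Proposition 1 (1.78), (1.80), (1.89), (1.102); and N12 OF RECORD over any Stage-₉
# record predicate that sets `res.W P` to that bundle

statement-level bookkeeping over published theorems with citation tags; kernel-checked compositions of tree theorems;
nothing here is a claim about the Yang–Mills mass gap.

CITATION HEADER (lean-in-tree rule).  Source: T. Bałaban, *Large field renormalization. I. The basic step of the 𝐑 operation*, Commun. Math.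
Phys. **122**, 175–202 (1989) [Balaban1989LargeFieldI] («[IV]»): (0.2)–(0.6) p. 176, Proposition 1 (1.78) p. 194, (1.80) p. 195, (1.89) p. 198,
(1.99)–(1.102) pp. 200–201; with [Balaban1988Convergent] («[III]»: (2.18) p. 257, (3.24)–(3.25) p. 270 — the represented tower).  Seat
`pub-ymgap-dag-n12-a` (YM-PLAN Track A, HUMAN RULING D-0062: the KNIT-BY-NAME seat of node N12), module 10 of the seat (g2).  BY NAME and UNCHANGED:
`…Node00.RepTowerOfRecord` (seat node00-def-T, FILE 2: `slotsOfRecord`, `slotsTOfRecord`, `repOfRecord9`, `repTOfRecord9`, `rhoOfRecord9`, `trhoOfRecord9`,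
`repOfRecord9_succ`, `slotsOfRecord_succ`, `holds_repTOfRecord9`), `…Node00.RStepSlotOfRecord ∕ RStepRepr218 ∕ LargeFieldTowerOfRecord` (seat node00-def-R:
`sliceOfRecord`, `rstepSlot`, `rstepSlotOfRecord`, `rstepOfSel_sliceOfRecord`, `rstepOfSel`, `rterm`, `repDataOfSel`, `fibOfSeq`, `PpSelOfRecord`),
`…B15LeafKnitRepr ∕ B15LeafKnitMass` (this seat, modules 8–9: `WOfRepr`, `knitOfRepr`, `b15Leaf_WOfRepr_of_mass`, `normalization04_knit_of_mass`,
`b15_main_of_refines₅C_WOfRepr_mass`), `…Node00.Record5C` (`upOfRecord₅C`), `…DagBinding`.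

WHY THIS FILE.  NODE 00 re-bases its record on the REPRESENTED TOWER (seat node00-def `STAGE6-9-DESIGN-g28.md` §2; chair R437): per run the (2.18)
representations `rep_k` (`repOfRecord9`) with `ρ_k := eval rep_k` (`rhoOfRecord9`), the T-step `Tstep rep_k` (`repTOfRecord9`, density `𝐓ρ_k = trhoOfRecord9`)
and the R-step of record (`rstepSlotOfRecord`, [IV] (0.3) at representation level), `rep_{k+1} = Rstep (Tstep rep_k)` (`repOfRecord9_succ`, `rfl`).  The
[IV] bundle `W P` of a run is to be BUILT FROM `R` there (seat node00-def `STAGE5-SCOPING-g28.md` §3 row `W P`).  Module 8 typed that bundle for an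
arbitrary (2.18) representation with selector and fibre bonds (`WOfRepr r sel fib LF D189 D1100`); THIS module reads it AT THE TOWER OF RECORD —
`r := repTOfRecord9 … p g k` (the pre-𝐑 representation the R-step acts on), `sel := ppSel p g (k+1)` (definer ₇b's residual selector `Z ↦ Z″`), `fib :=
fibOfSeq … (k+1)` (the `Z′`-variables of the sequences of record) — and records, by `rfl`, that the knit's objects ARE the record's: the 𝐑-step of that
representation IS `rep_{k+1}` (`rstepOfSel_repTOfRecord9`), the knit's `ρ_k` IS `𝐓ρ_k` (`sum_rterm_repTOfRecord9`), the leaf's (0.4) number is `∫dV 𝐓ρ_k`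
(`integral_rop_WOfTower9_eq`).  §3–§4: the B15 leaf at the tower pin from the POSITIVE-MASS provisos on the tower's pre-𝐑 terms `χ_{k+1}(s)·(𝐓e^A)_{k+1}(s)`
(module 9; chair R446 (A) «(R-C2) MASS∕SUPPORT reading») modulo EXACTLY the four printed displays, and N12 = `Dag.B15_main (leavesP w P)` at every run of
every record world of ANY refinement `Θ → Stage5Params` keeping the C-binding whose Stage-5 view sets
`res.W P := WOfRepr (repTOfRecord9 …) (ppSel …) (fibOfSeq …) (LF P) (D189 P) (D1100 P)` — the discharge shape of N12 at Stage ₉ modulo [IV]'s estimates.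

WHAT THIS FILE PROVES (0 `sorry`, 0 `def`, standard axioms).
§1 `repTOfRecord9_eq_sliceOfRecord` (`rfl`), **`rstepOfSel_repTOfRecord9`** (the R-step of the W-pin's representation IS `rep_{k+1}` of the tower, `rfl` at
   definer ₇'s classical bond decidability — TS-8), `sum_rterm_repTOfRecord9` (the knit's `ρ_k` IS `𝐓ρ_k`, `rfl`), `WOfTower9_LF` (`rfl`).
§2 `integral_rop_WOfTower9_eq` (the leaf's (0.4) left side at the tower pin = `∫dV 𝐓ρ_k`, mass form).
§3 **`b15Leaf_WOfTower9_of_mass`** (the leaf at the tower pin ⇐ pre-𝐑 terms measurable ∕ ≥ 0 ∕ bounded ∕ positive mass + EXACTLY Prop 1 (1.78), (1.80),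
   (1.89), (1.102) at `𝐓ρ_k`).
§4 **`b15_main_of_refines₅C_WOfTower9`** (N12 OF RECORD at Stage ₉: any refinement pinning `res.W P` to the tower bundle ⇒ N12 at every run of every
   record world, modulo the provisos and the four displays).

HONEST FRAMING.  A count-neutral landing (R429 (4)(i)): the W-pin proposal of modules 7–9 instantiated BY NAME at definer ₇b∕₉'s tower of record;
`res.W P := …` is NODE 00's definition to make (located question of module 7: which step `k(P)`); N12 is NOT discharged — after the pin it is the
positive-mass provisos + EXACTLY Proposition 1 (1.78), (1.80), (1.89) (+ (1.102) or the 𝐑′ = 𝐑-step identification) at the objects of record, whose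
in-edge suppliers are located in `HOME/pub-ymgap-dag-n12-a/N12-DOSSIER.md` §6; nothing of Bałaban's asserted or proved here; one finite four-torus
programme at fixed `ε`, Bałaban AS PRINTED with locators; nothing continuum ∕ ℝ⁴ ∕ OS ∕ mass gap ∕ Clay.
-/

noncomputable section

open scoped BigOperators
open MeasureTheory

namespace Literature.MathematicalPhysics.QuantumFieldTheory.Balaban1983to89.B15LeafKnitTower9

open DagBinding T4Continuum Node00
open B15 (Rop Prop1Printed Ineq180)
open B15.BasicStep (fibreIntegral Claim189)
open B15Sect1Statements (RPrimeData Normalization1102)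
open B15Claim189Assembly (Setting189 new189 chiPP dom)
open B8Eq17ClassAkV1 (plaqsOf)
open B15LeafKnit (knitRData)
open B15LeafKnitRepr (knitOfRepr WOfRepr)
open B15LeafKnitRecord7 (b15_main_of_refines₅C_of_leaf)
open B15LeafKnitMass (b15Leaf_WOfRepr_of_mass normalization04_knit_of_mass)

variable {F : T4Family} {N : ℕ} [NeZero N]

/-! ## §1. The W-pin's representation, selector and fibre bonds ARE the tower's (`rfl`) -/

section Junction

variable (ν : Stage7Numerics) (τ : TowerNumerics) (E : B12.RunParams → ℝ) (w : StepWeightsOfRecord F N ν τ.M)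
  (ppSel : PpSelOfRecord F ν τ.M) (p : B12.RunParams) (g : ℕ → ℝ) (k : ℕ)

/-- The pre-𝐑 representation `Tstep rep_k` of the tower of record IS definer ₇'s slice of the pre-𝐑 slot family at level `k+1` (`rfl`).
[cite: Balaban1988Convergent, (2.18) p.257, (3.25) p.270 (bookkeeping)] -/
theorem repTOfRecord9_eq_sliceOfRecord :
    repTOfRecord9 F N ν τ E w ppSel p g k
      = sliceOfRecord F N ν τ.M p g (k + 1) (slotsTOfRecord F N ν τ E w ppSel p g (k + 1)) := rfl

/-- **The 𝐑-step of the W-pin's representation IS `rep_{k+1}` of the tower of record**: R-stepping `Tstep rep_k` with the selector of record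
`ppSel p g (k+1)` and the fibre bond sets `fibOfSeq … (k+1)` gives `repOfRecord9 … (k+1)` (`rfl`: `repOfRecord9_succ`, `rstepOfRecord_eq_sliceOfRecord`,
`rstepOfSel_sliceOfRecord`).  Stated at definer ₇'s CLASSICAL bond decidability (inline `letI`), the instance `rstepSlotOfRecord` synthesises (TS-8).
[cite: Balaban1989LargeFieldI, (0.3) p.176; Balaban1988Convergent, Theorem 1 p.262 («has again the form (2.18)»)] -/
theorem rstepOfSel_repTOfRecord9 :
    letI : DecidableEq (PBond (F.P p.K) (k + 1)) := fun a b => Classical.propDecidable (a = b)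
    rstepOfSel (repTOfRecord9 F N ν τ E w ppSel p g k) (ppSel p g (k + 1)) (fibOfSeq F ν τ p g (k + 1))
      = repOfRecord9 F N ν τ E w ppSel p g (k + 1) := rfl

/-- **The knit record's `ρ_k` at the tower pin IS `𝐓ρ_k` of record**: `Σ_s t_s = Σ_s χ_{k+1}(s)·(𝐓e^A)_{k+1}(s) = trhoOfRecord9 … k` (`rfl`).
[cite: Balaban1988Convergent, (3.25) p.270, (2.18) p.257 (bookkeeping)] -/
theorem sum_rterm_repTOfRecord9 :
    (fun V => ∑ s, rterm (repTOfRecord9 F N ν τ E w ppSel p g k) s V) = trhoOfRecord9 F N ν τ E w ppSel p g k := rfl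

variable {P₀ : Params} {C ι : Type} (LF : B15.LFVar) (D189 : Setting189 P₀ (SU N) C ι) (D1100 : RPrimeData (F.P p.K) (k + 1) (SU N))
  [DecidableEq (PBond (F.P p.K) (k + 1))]

/-- The Proposition-1 carrier of the tower bundle is `LF` (`rfl`). [cite: Balaban1989LargeFieldI, Prop. 1 p.194 (bookkeeping)] -/
theorem WOfTower9_LF :
    (WOfRepr (repTOfRecord9 F N ν τ E w ppSel p g k) (ppSel p g (k + 1)) (fibOfSeq F ν τ p g (k + 1)) LF D189 D1100).LF = LF := rfl

omit [DecidableEq (PBond (F.P p.K) (k + 1))] in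
/-- The knit record's `ρ_k` field at the tower pin is `𝐓ρ_k` of record (`rfl`). [cite: Balaban1989LargeFieldI, (1.102) p.201 (the density 𝐑′ normalises; bookkeeping)] -/
theorem knitOfTower9_ρk :
    (knitOfRepr (repTOfRecord9 F N ν τ E w ppSel p g k) (ppSel p g (k + 1)) (fibOfSeq F ν τ p g (k + 1)) LF D189 D1100).ρk
      = trhoOfRecord9 F N ν τ E w ppSel p g k := rfl

end Junction

/-! ## §2. The leaf's (0.4) number at the tower pin -/

section Numbers

variable (ν : Stage7Numerics) (τ : TowerNumerics) (E : B12.RunParams → ℝ) (w : StepWeightsOfRecord F N ν τ.M)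
  (ppSel : PpSelOfRecord F ν τ.M) (p : B12.RunParams) (g : ℕ → ℝ) (k : ℕ) [DecidableEq (PBond (F.P p.K) (k + 1))]

/-- **The binding's (0.4) left side at the tower pin computes `∫dV 𝐓ρ_k`**: with the pre-𝐑 terms `t_s = χ_{k+1}(s)·(𝐓e^A)_{k+1}(s)` measurable, nonnegative,
uniformly bounded and the denominator terms `t_{s″}` of positive mass, `∫dV 𝐑(knitRData t (ppSel p g (k+1)) (fibOfSeq … (k+1))) = ∫dV Σ_s t_s = ∫dV 𝐓ρ_k`
(module 9 `normalization04_knit_of_mass`, the scalar (0.4)). [cite: Balaban1989LargeFieldI, (0.4) p.176; Balaban1988Convergent, (3.25) p.270] -/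
theorem integral_rop_WOfTower9_eq (hm : ∀ s, Measurable (rterm (repTOfRecord9 F N ν τ E w ppSel p g k) s))
    (h0 : ∀ s V, 0 ≤ rterm (repTOfRecord9 F N ν τ E w ppSel p g k) s V) {Cρ : ℝ}
    (hC : ∀ s V, rterm (repTOfRecord9 F N ν τ E w ppSel p g k) s V ≤ Cρ)
    (hmass : ∀ s, 0 < ∫ V, rterm (repTOfRecord9 F N ν τ E w ppSel p g k) (ppSel p g (k + 1) s) V ∂(fieldMeasure (F.P p.K) (k + 1) (SU N))) :
    (∫ V, Rop (knitRData (rterm (repTOfRecord9 F N ν τ E w ppSel p g k)) (ppSel p g (k + 1)) (fibOfSeq F ν τ p g (k + 1))) V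
        ∂(fieldMeasure (F.P p.K) (k + 1) (SU N)))
      = ∫ V, trhoOfRecord9 F N ν τ E w ppSel p g k V ∂(fieldMeasure (F.P p.K) (k + 1) (SU N)) := by
  rw [← sum_rterm_repTOfRecord9]
  exact normalization04_knit_of_mass _ _ _ hm h0 hC hmass

end Numbers

/-! ## §3. The B15 leaf at the tower pin -/

section Leaf

variable (ν : Stage7Numerics) (τ : TowerNumerics) (E : B12.RunParams → ℝ) (w : StepWeightsOfRecord F N ν τ.M)
  (ppSel : PpSelOfRecord F ν τ.M) (p : B12.RunParams) (g : ℕ → ℝ) (k : ℕ) [DecidableEq (PBond (F.P p.K) (k + 1))]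
  {P₀ : Params} {C ι : Type} (LF : B15.LFVar) (D189 : Setting189 P₀ (SU N) C ι) (D1100 : RPrimeData (F.P p.K) (k + 1) (SU N))

/-- **THE B15 LEAF AT THE TOWER PIN** `WOfRepr (Tstep rep_k) (ppSel p g (k+1)) (fibOfSeq … (k+1)) LF D189 D1100`: from the pre-𝐑 terms of the tower of
record measurable, nonnegative, uniformly bounded and of POSITIVE MASS (p. 176 ll. 14–16 in the (R-C2) reading) and EXACTLY the four displayed printed
statements — Proposition 1 (1.78) on `LF`, (1.80) on the ℍ-domains of `D189`, (1.89), (1.102) for `D1100` at `𝐓ρ_k` of record ((0.4), (0.6) PROVED).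
[cite: Balaban1989LargeFieldI, (0.2)–(0.6) p.176, Prop. 1 (1.78) p.194, (1.80) p.195, (1.89) p.198, (1.102) p.201; Balaban1988Convergent, (3.25) p.270] -/
theorem b15Leaf_WOfTower9_of_mass (hm : ∀ s, Measurable (rterm (repTOfRecord9 F N ν τ E w ppSel p g k) s))
    (h0 : ∀ s V, 0 ≤ rterm (repTOfRecord9 F N ν τ E w ppSel p g k) s V) {Cρ : ℝ}
    (hC : ∀ s V, rterm (repTOfRecord9 F N ν τ E w ppSel p g k) s V ≤ Cρ)
    (hmass : ∀ s, 0 < ∫ V, rterm (repTOfRecord9 F N ν τ E w ppSel p g k) s V ∂(fieldMeasure (F.P p.K) (k + 1) (SU N)))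
    (hP1 : Prop1Printed LF)
    (h180 : ∀ U, new189 D189 U → ∀ i, D189.h ≤ i → i ≤ D189.k → ∀ q ∈ plaqsOf (dom D189 i),
      Ineq180 (D189.dev0 U q) (D189.ε D189.k) D189.η D189.B₃ D189.B₅ D189.M D189.δ (D189.dist q) D189.O1)
    (h189 : Claim189 (new189 D189) (chiPP D189))
    (h1102 : Normalization1102 D1100 (trhoOfRecord9 F N ν τ E w ppSel p g k)) :
    B15Leaf (WOfRepr (repTOfRecord9 F N ν τ E w ppSel p g k) (ppSel p g (k + 1)) (fibOfSeq F ν τ p g (k + 1)) LF D189 D1100) :=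
  b15Leaf_WOfRepr_of_mass _ _ _ LF D189 D1100 hm h0 hC hmass hP1 h180 h189 (by rw [sum_rterm_repTOfRecord9]; exact h1102)

end Leaf

/-! ## §4. N12 OF RECORD at Stage ₉: any refinement pinning `res.W P` to the tower bundle -/

section Hook

variable {w : WorldP}

/-- **N12 OF RECORD AT THE REPRESENTED TOWER.**  For ANY parameter type `Θ` with Stage-5 view `toS5` and admissibility `Adm` whose record worlds bind
`w.up P = upOfRecord₅C (toS5 θ) P` and whose Stage-5 view PINS the [IV] bundle of every run to the tower bundle — `(toS5 θ).res.W P = WOfRepr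
(repTOfRecord9 F N (ν θ) (τ θ) (E θ) (sw θ) (sel θ) P (g θ P) (k θ P)) (sel θ P (g θ P) (k θ P + 1)) (fibOfSeq F (ν θ) (τ θ) P (g θ P) (k θ P + 1)) (LF θ P)
(D189 θ P) (D1100 θ P)` (the run's numerics, vacuum energy, step weights, selector, couplings `g θ P` and the step `k θ P` the binding reads, all
functions of the parameters) —, N12 = `Dag.B15_main (leavesP w P)` holds at every run of every record world from: the pre-𝐑 terms of the tower at
`(θ, P)` measurable ∕ nonnegative ∕ bounded ∕ of positive mass, and EXACTLY Proposition 1 (1.78), (1.80) on the ℍ-domains, (1.89), (1.102) at the objects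
of record.  THE discharge shape of N12 at Stage ₉ modulo [IV]'s printed estimates. [cite: Balaban1989LargeFieldI, Prop. 1 (1.78) p.194, (0.2)–(0.6) p.176, (1.80) p.195, (1.89) p.198, (1.102) p.201; Balaban1988Convergent, (2.18) p.257, (3.25) p.270] -/
theorem b15_main_of_refines₅C_WOfTower9 {Θ : Type*} (toS5 : Θ → Stage5Params F N) (Adm : Θ → Prop)
    (ν : Θ → Stage7Numerics) (τ : Θ → TowerNumerics) (E : Θ → B12.RunParams → ℝ) (sw : ∀ θ, StepWeightsOfRecord F N (ν θ) (τ θ).M)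
    (sel : ∀ θ, PpSelOfRecord F (ν θ) (τ θ).M) (g : Θ → B12.RunParams → ℕ → ℝ) (k : Θ → B12.RunParams → ℕ)
    [∀ θ (Pr : B12.RunParams), DecidableEq (PBond (F.P Pr.K) (k θ Pr + 1))]
    {P₀ : Θ → B12.RunParams → Params} {Cfg ι : Θ → B12.RunParams → Type}
    (LF : Θ → B12.RunParams → B15.LFVar) (D189 : ∀ θ Pr, Setting189 (P₀ θ Pr) (SU N) (Cfg θ Pr) (ι θ Pr))
    (D1100 : ∀ θ (Pr : B12.RunParams), RPrimeData (F.P Pr.K) (k θ Pr + 1) (SU N))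
    (hpin : ∀ θ, Adm θ → ∀ Pr : B12.RunParams,
      (toS5 θ).res.W Pr = WOfRepr (repTOfRecord9 F N (ν θ) (τ θ) (E θ) (sw θ) (sel θ) Pr (g θ Pr) (k θ Pr))
        (sel θ Pr (g θ Pr) (k θ Pr + 1)) (fibOfSeq F (ν θ) (τ θ) Pr (g θ Pr) (k θ Pr + 1)) (LF θ Pr) (D189 θ Pr) (D1100 θ Pr))
    (hm : ∀ θ, Adm θ → ∀ (Pr : B12.RunParams) s, Measurable (rterm (repTOfRecord9 F N (ν θ) (τ θ) (E θ) (sw θ) (sel θ) Pr (g θ Pr) (k θ Pr)) s))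
    (h0 : ∀ θ, Adm θ → ∀ (Pr : B12.RunParams) s V, 0 ≤ rterm (repTOfRecord9 F N (ν θ) (τ θ) (E θ) (sw θ) (sel θ) Pr (g θ Pr) (k θ Pr)) s V)
    (hC : ∀ θ, Adm θ → ∀ Pr : B12.RunParams, ∃ Cρ : ℝ, ∀ s V,
      rterm (repTOfRecord9 F N (ν θ) (τ θ) (E θ) (sw θ) (sel θ) Pr (g θ Pr) (k θ Pr)) s V ≤ Cρ)
    (hmass : ∀ θ, Adm θ → ∀ (Pr : B12.RunParams) s,
      0 < ∫ V, rterm (repTOfRecord9 F N (ν θ) (τ θ) (E θ) (sw θ) (sel θ) Pr (g θ Pr) (k θ Pr)) s V ∂(fieldMeasure (F.P Pr.K) (k θ Pr + 1) (SU N)))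
    (hP1 : ∀ θ, Adm θ → ∀ Pr : B12.RunParams, Prop1Printed (LF θ Pr))
    (h180 : ∀ θ, Adm θ → ∀ (Pr : B12.RunParams) U, new189 (D189 θ Pr) U → ∀ i, (D189 θ Pr).h ≤ i → i ≤ (D189 θ Pr).k →
      ∀ q ∈ plaqsOf (dom (D189 θ Pr) i),
      Ineq180 ((D189 θ Pr).dev0 U q) ((D189 θ Pr).ε (D189 θ Pr).k) (D189 θ Pr).η (D189 θ Pr).B₃ (D189 θ Pr).B₅ (D189 θ Pr).M
        (D189 θ Pr).δ ((D189 θ Pr).dist q) (D189 θ Pr).O1)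
    (h189 : ∀ θ, Adm θ → ∀ Pr : B12.RunParams, Claim189 (new189 (D189 θ Pr)) (chiPP (D189 θ Pr)))
    (h1102 : ∀ θ, Adm θ → ∀ Pr : B12.RunParams,
      Normalization1102 (D1100 θ Pr) (trhoOfRecord9 F N (ν θ) (τ θ) (E θ) (sw θ) (sel θ) Pr (g θ Pr) (k θ Pr)))
    (hw : ∃ θ, Adm θ ∧ ∀ Pr, w.up Pr = upOfRecord₅C F N (toS5 θ) Pr) (Pr : B12.RunParams) : Dag.B15_main (leavesP w Pr) := by
  refine b15_main_of_refines₅C_of_leaf toS5 Adm (fun θ hθ Pr => ?_) hw Pr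
  rw [hpin θ hθ Pr]
  obtain ⟨Cρ, hCρ⟩ := hC θ hθ Pr
  exact b15Leaf_WOfTower9_of_mass (ν θ) (τ θ) (E θ) (sw θ) (sel θ) Pr (g θ Pr) (k θ Pr) (LF θ Pr) (D189 θ Pr) (D1100 θ Pr)
    (hm θ hθ Pr) (h0 θ hθ Pr) hCρ (hmass θ hθ Pr) (hP1 θ hθ Pr) (h180 θ hθ Pr) (h189 θ hθ Pr) (h1102 θ hθ Pr)

end Hook

end Literature.MathematicalPhysics.QuantumFieldTheory.Balaban1983to89.B15LeafKnitTower9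

end
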